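import Mathlib
import Summits.ResolutionOfSingularities.ResolutionOfSingularities.Theorems.FrobeniusLadderFRationalResolutionCompletedBaseChangeFibrePoints
import Summits.ResolutionOfSingularities.ResolutionOfSingularities.Theorems.FrobeniusLadderFRationalResolutionCompletedBaseChangeFibreFinite
import Summits.ResolutionOfSingularities.ResolutionOfSingularities.Theorems.FrobeniusLadderFRationalResolutionCompletedBaseChangeFibreTransport
import Summits.ResolutionOfSingularities.ResolutionOfSingularities.Theorems.FrobeniusLadderFRationalResolutionSingularPointsFinite
import Summits.ResolutionOfSingularities.ResolutionOfSingularities.Theorems.FrobeniusLadderFRationalResolutionSingularPointsOverVertex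

/-!
# Crux `FrobeniusLadder.FRationalResolution` (stmt-ResolutionOfSingularities-15317), line `redirect`,
# stub `stub_diagonalizableQuotientResolution` — THE TRANSPORT STEP (T) ASSEMBLED: **`hloc` at a twisted isolated point from
# chart-level facts about the naive two-step recipe on a MODEL `T` (e.g. the toric chart ring `κ[P]`) with `(T_𝔳)^ ≅ Ê`**

Eighth and last file of the (T) series (`…CompletedBaseChangeFibre`, `…Flat`, `…Chart`, `…Completion`, `…Points`, `…Finite`,
`…Transport`). The naive two-step recipe `…SingularPointsFinite.hloc_of_maximalIdealPow_then_finite_singularPoints` (p840034)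
settles the twisted point of the Galois route as soon as `X₁ = Bl_{𝔪̂^{a+1}}(Spec Ê)`, `Ê = ((B ⊗_K K')_{𝔔'})^`, has finitely many
singular points each with `Bl_{𝔪_z}(Spec 𝒪_{X₁,z})` regular. Here these two scheme-level hypotheses are DISCHARGED from a model:
* ★★★ **`hloc_of_model_charts`** — Galois data as in p840034; a MODEL `T` of finite type over a field `κ` with a maximal ideal `𝔳`,
  `Spec T` regular at the primes `⊊ 𝔳` (isolated singularity), a ring isomorphism `(T_𝔳)^ ≅ Ê` (for the diagonalizable-quotient
  points: `T = κ(𝔔')[P]`, g19/g20 `…MonomialAlgebraCompletion` + `…FixedPointCompletionChart` / `…HfinOfChartData`), generators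
  `x₁, …, x_n` of `𝔳^{a+1}`, and ON THE MODEL CHART RINGS `T[𝔳^{a+1}/x_i]`: finitely many non-regular primes over `V(𝔳)`, at each
  of which the point blow-up `Bl_𝔪(Spec T[𝔳^{a+1}/x_i]_𝔫)` is regular ⇒ **`hloc` at the twisted point `ι(𝔭)`** (a neighbourhood
  `V` with a proper `Y → V`, `Y` regular, isomorphic over `Reg X`, dense preimage).
Pipeline: singular points of `Bl_{𝔳^{a+1}(T_𝔳)^}` lie over `V(𝔪̂)` (`…SingularPointsOverVertex`), `hfin` / `hloc` there from the
charts (`…Finite.finite_compl_regularLocus_of_model_charts`, `…Points.hloc_stalk_of_model_charts`), transport to `Ê` along the ring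
isomorphism (`…Transport.hfin_hloc_of_ringEquiv`; powers of the maximal ideal match), then p840034. So for the naive two-step recipe
what is left at a twisted isolated point is ONLY the chart computation on the model (the fan facts (β) of MEMO-15317-leafhand2-g17
§5: 6 classes `r ≤ 21` beyond the 68 one-step classes) and the ring isomorphism `(κ'[P]_𝔳)^ ≅ Ê` (g19/g20).

Honest label: assembly toward ONE leaf stub (no stub, crux or summit closed). No definitions, no named facts, no sorry.
[cite: StacksProject, Tag 080B; Tag 0804; Tag 0805] [cite: Matsumura1987, Thm. 8.11; Thm. 8.14; Thm. 23.7]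
[cite: GortzWedhorn2020, Prop. 13.91] [cite: Kollar2007, §2.2]
-/

noncomputable section

-- single-problem summit: the doubled namespace component is forced
set_option linter.dupNamespace false

open CategoryTheory AlgebraicGeometry IsLocalRing
open scoped TensorProduct
open Literature.AlgebraicGeometry.Resolution

namespace Summit.ResolutionOfSingularities.ResolutionOfSingularities.Theorems.FRationalResolution.CompletedBaseChangeFibreAssembly

/-- ★★★ **`hloc` AT A TWISTED POINT FROM THE MODEL CHARTS.** See the module docstring.
[cite: StacksProject, Tag 080B; Tag 0804; Tag 0805] [cite: Matsumura1987, Thm. 8.11; Thm. 8.14; Thm. 23.7] [cite: Kollar2007, §2.2] -/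
theorem hloc_of_model_charts (K : Type) [Field K] (X : Scheme.{0}) [IsIntegral X]
    (f : X ⟶ Spec (.of K)) [LocallyOfFiniteType f]
    {B : Type} [CommRing B] [IsDomain B] [Algebra K B] [Algebra.FiniteType K B]
    (ι : Spec (.of B) ⟶ X) [IsOpenImmersion ι] (hι : ι ≫ f = Spec.map (CommRingCat.ofHom (algebraMap K B)))
    (𝔭 : Ideal B) [h𝔭 : 𝔭.IsMaximal] (h𝔭0 : 𝔭 ≠ ⊥)
    (hsing : ι ⟨𝔭, h𝔭.isPrime⟩ ∉ Scheme.regularLocus X)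
    (hregB : ∀ P : Spec (.of B), P.asIdeal ≠ 𝔭 → P ∈ Scheme.regularLocus (Spec (.of B)))
    (K' : Type) [Field K'] [Algebra K K'] [FiniteDimensional K K'] [IsGalois K K']
    (𝔔' : Ideal (B ⊗[K] K')) [h𝔔' : 𝔔'.IsMaximal] (h𝔔'𝔭 : 𝔔'.comap (algebraMap B (B ⊗[K] K')) = 𝔭) (a : ℕ)
    -- the model
    (κ : Type) [Field κ] (T : Type) [CommRing T] [Algebra κ T] [Algebra.FiniteType κ T] (𝔳 : Ideal T) [𝔳.IsMaximal]
    (hoff : ∀ t : Spec (.of T), t.asIdeal ≤ 𝔳 → t.asIdeal ≠ 𝔳 → t ∈ Scheme.regularLocus (Spec (.of T)))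
    (e : AdicCompletion (maximalIdeal (Localization.AtPrime 𝔳)) (Localization.AtPrime 𝔳) ≃+*
      AdicCompletion (maximalIdeal (Localization.AtPrime 𝔔')) (Localization.AtPrime 𝔔'))
    {n : ℕ} (x : Fin n → T) (hx : 𝔳 ^ (a + 1) = Ideal.span (Set.range x))
    (hfin : ∀ i : Fin n, {𝔫 : PrimeSpectrum (blowupAlgebra (𝔳 ^ (a + 1)) (x i)) |
      𝔳.map (algebraMap T (blowupAlgebra (𝔳 ^ (a + 1)) (x i))) ≤ 𝔫.asIdeal ∧
        ¬ IsRegularLocalRing (Localization.AtPrime 𝔫.asIdeal)}.Finite)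
    (hmodel : ∀ (i : Fin n) (𝔫 : PrimeSpectrum (blowupAlgebra (𝔳 ^ (a + 1)) (x i))),
      𝔳.map (algebraMap T (blowupAlgebra (𝔳 ^ (a + 1)) (x i))) ≤ 𝔫.asIdeal →
      ¬ IsRegularLocalRing (Localization.AtPrime 𝔫.asIdeal) →
      Scheme.IsRegular (affineBlowup (R := Localization.AtPrime 𝔫.asIdeal)
        (maximalIdeal (Localization.AtPrime 𝔫.asIdeal)))) :
    ∃ (V : X.Opens), ι ⟨𝔭, h𝔭.isPrime⟩ ∈ V ∧
      (∀ t : X, t ∉ Scheme.regularLocus X → t ∈ V → t = ι ⟨𝔭, h𝔭.isPrime⟩) ∧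
      ∃ (Y : Scheme.{0}) (ρ : Y ⟶ V), IsProper ρ ∧ Scheme.IsRegular Y ∧
        IsIso (ρ ∣_ (V.ι ⁻¹ᵁ ⟨Scheme.regularLocus X, isOpen_regularLocus_of_locallyOfFiniteType_field f⟩)) ∧
        Dense ((ρ ⁻¹ᵁ (V.ι ⁻¹ᵁ ⟨Scheme.regularLocus X,
          isOpen_regularLocus_of_locallyOfFiniteType_field f⟩) : Y.Opens) : Set Y) := by
  -- instances on the Galois side (as in p840034)
  haveI : IsNoetherianRing B := Algebra.FiniteType.isNoetherianRing K B
  haveI : Algebra.FiniteType B (B ⊗[K] K') := inferInstance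
  haveI : IsNoetherianRing (B ⊗[K] K') := Algebra.FiniteType.isNoetherianRing B (B ⊗[K] K')
  haveI : IsNoetherianRing (Localization.AtPrime 𝔔') :=
    IsLocalization.isNoetherianRing 𝔔'.primeCompl (Localization.AtPrime 𝔔') inferInstance
  have hfac : algebraMap (B ⊗[K] K') (AdicCompletion (maximalIdeal (Localization.AtPrime 𝔔')) (Localization.AtPrime 𝔔')) =
      (algebraMap (Localization.AtPrime 𝔔') _).comp (algebraMap (B ⊗[K] K') (Localization.AtPrime 𝔔')) :=
    RingHom.ext fun _ => rfl
  have hmapQ : 𝔔'.map (algebraMap (B ⊗[K] K') (AdicCompletion (maximalIdeal (Localization.AtPrime 𝔔'))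
      (Localization.AtPrime 𝔔'))) = maximalIdeal _ := by
    rw [hfac, ← Ideal.map_map, Localization.AtPrime.map_eq_maximalIdeal, ← AdicCompletion.maximalIdeal_eq_map]
  -- instances on the model side
  haveI : IsNoetherianRing T := Algebra.FiniteType.isNoetherianRing κ T
  haveI : IsNoetherianRing (Localization.AtPrime 𝔳) :=
    IsLocalization.isNoetherianRing 𝔳.primeCompl (Localization.AtPrime 𝔳) inferInstance
  haveI : IsNoetherianRing (AdicCompletion (maximalIdeal (Localization.AtPrime 𝔳)) (Localization.AtPrime 𝔳)) :=
    isNoetherianRing_adicCompletion_maximalIdeal _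
  -- singular points of the model blow-up lie over `V(𝔪̂)`
  have hReg : ∀ Q : Spec (.of (AdicCompletion (maximalIdeal (Localization.AtPrime 𝔳)) (Localization.AtPrime 𝔳))),
      ¬ 𝔳.map (algebraMap T _) ≤ Q.asIdeal → Q ∈ Scheme.regularLocus _ := fun Q hQ =>
    SingularPointsOverVertex.mem_regularLocus_Spec_adicCompletion_of_not_le κ 𝔳 hoff Q hQ
  have hZ' := SingularPointsOverVertex.le_of_not_mem_regularLocus_of_pow_le
    (𝔳.map (algebraMap T (AdicCompletion (maximalIdeal (Localization.AtPrime 𝔳)) (Localization.AtPrime 𝔳))))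
    ((𝔳 ^ (a + 1)).map (algebraMap T _)) (n := a + 1) (by rw [Ideal.map_pow])
    (by rw [Ideal.map_pow]; exact Ideal.pow_le_self (Nat.succ_ne_zero a)) hReg
  have hZ : ∀ z : affineBlowup ((𝔳 ^ (a + 1)).map (algebraMap T (AdicCompletion (maximalIdeal (Localization.AtPrime 𝔳))
      (Localization.AtPrime 𝔳)))), z ∉ Scheme.regularLocus _ →
      𝔳 ≤ (affineBlowup.π _ z).asIdeal.comap (algebraMap T _) := fun z hz =>
    Ideal.map_le_iff_le_comap.mp (hZ' z hz)
  -- `hfin` and `hloc` on the model blow-up, from the charts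
  have hfinm := CompletedBaseChangeFibreFinite.finite_compl_regularLocus_of_model_charts κ T 𝔳 x (𝔳 ^ (a + 1)) hx hfin hZ
  have hlocm : ∀ z ∈ (Scheme.regularLocus (affineBlowup ((𝔳 ^ (a + 1)).map (algebraMap T
      (AdicCompletion (maximalIdeal (Localization.AtPrime 𝔳)) (Localization.AtPrime 𝔳))))))ᶜ,
      Scheme.IsRegular (affineBlowup (R := (affineBlowup ((𝔳 ^ (a + 1)).map (algebraMap T
        (AdicCompletion (maximalIdeal (Localization.AtPrime 𝔳)) (Localization.AtPrime 𝔳))))).presheaf.stalk z)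
        (maximalIdeal _)) := fun z hz =>
    CompletedBaseChangeFibrePoints.hloc_stalk_of_model_charts κ T 𝔳 x (𝔳 ^ (a + 1)) hx hmodel z (hZ z hz)
      (by rwa [Set.mem_compl_iff, Scheme.mem_regularLocus] at hz)
  -- transport along `e`
  obtain ⟨hfin', hloc'⟩ := CompletedBaseChangeFibreTransport.hfin_hloc_of_ringEquiv e _ hfinm hlocm
  -- the centre upstairs is `(𝔔'Ê)^{a+1}`
  have hJ : ((𝔳 ^ (a + 1)).map (algebraMap T (AdicCompletion (maximalIdeal (Localization.AtPrime 𝔳))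
      (Localization.AtPrime 𝔳)))).map (e : _ →+* _) =
      (𝔔'.map (algebraMap (B ⊗[K] K') (AdicCompletion (maximalIdeal (Localization.AtPrime 𝔔'))
        (Localization.AtPrime 𝔔')))) ^ (a + 1) := by
    rw [Ideal.map_pow, Ideal.map_pow, CompletedBaseChangeFibreFlat.map_eq_maximalIdeal_adicCompletion T 𝔳,
      PointBlowupOfCompletion.map_maximalIdeal_ringEquiv e, hmapQ]
  rw [hJ] at hfin' hloc'
  exact SingularPointsFinite.hloc_of_maximalIdealPow_then_finite_singularPoints K X f ι hι 𝔭 h𝔭0 hsing hregB K' 𝔔' h𝔔'𝔭 a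
    hfin' hloc'

end Summit.ResolutionOfSingularities.ResolutionOfSingularities.Theorems.FRationalResolution.CompletedBaseChangeFibreAssembly

end
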